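/-
Copyright (c) 2026 the pub-hodgecm-mathlib formalisation cell (harness21).  Prover seat hodgecm-mathlib-K2E5-p16 (g9): Track B «K2-LIT», hLiu418 = stmt-HodgeConjecture-24832,
road `K2_Liu`, K1-a♮ (Iw-S₀) road (R2′) «monomial-flat at ★ p863501's interface», FILE A (K1a desk K2Liu-p01 (g11) WORD #1 (2), 2026-09-05):
THE LOCAL IWASAWA HEIGHT OF A STANDARD DATUM HAS SQUARE IN `q_v^ℤ`.
-/
import Summits.HodgeConjecture.HodgeConjecture.Theorems.K2LiuStdFamilyAwayPurityFlat   -- ★ (E6) FILE 2: `heightLoc_siegel_mul`, `heightLoc_mul_of_mem`, `continuous_heightLoc`, `isOpen_coe_comap_locToAdelic`; brings ★ (E6) FILE 1 `modDelta_pPart_eq_of_componentwise`, ★ G2 §0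
import Summits.HodgeConjecture.HodgeConjecture.Theorems.K2LiuFlatSiegelFamilies          -- ★ B2: `exists_absDetDelta_eq_zpow`
import Literature.NumberTheory.K2Lit.LocalDoublingSiegel                                -- ★ `siegelDeltaLoc`, `mem_siegelDeltaLoc_iff_local`, `isUnit_localDetDelta_of_mem_siegelDeltaLoc`
import HarnessLib

/-!
# Crux `HLiu418`, road `K2_Liu`, K1-a♮ (Iw-S₀) road (R2′), FILE A: the local Iwasawa height `H_{𝒦,v}(u) := |det_Δ p_{ι_v u}|^{1∕2}` has `H_{𝒦,v}(u)² ∈ q_v^ℤ`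

Cell `hodgecm-mathlib`, crux item hLiu418 = `stmt-HodgeConjecture-24832`; squad K2; prover K2E5-p16 (g9).  THEOREMS ONLY (no `def`, no instance, no notation,
no named-fact hypothesis, no `sorry`); lane `--supports stmt-HodgeConjecture-24832 --as helper`.

For an Iwasawa datum `𝒦` (★ K2Lit `IwasawaDatum`: `K ≤ H(𝔸)` compact, `H(𝔸) = P_Δ(𝔸)·K`) the LOCAL IWASAWA HEIGHT at a finite place `v` of `L⁺` is
`H_{𝒦,v}(u) := modDelta (𝒦.pPart (ι_v u))` (`u ∈ H_v = H(L⁺_v)`, `ι_v` = ★ `locToAdelic v`), the function whose power `H_{𝒦,v}^{2(s−s₀)}` twists local sections in the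
flat families of ★ (E6) FILE 2 `K2LiuStdFamilyAwayPurityFlat` (left `P_Δ(L⁺_v)`-law ★ `heightLoc_siegel_mul`, right `ι_v⁻¹(𝒦.K)`-invariance ★ `heightLoc_mul_of_mem`).
THIS FILE: for `𝒦` STANDARD (★ `IwasawaDatum.IsStd`: `K = C_∞·C_f`, `C_f` open compact — NOT assumed to be a product over the places),

* §1 `modDelta_locToAdelic_sq_eq_absDetDelta`: on `P_Δ(L⁺_v)` the adelic modulus read at `ι_v` squares to ★ D1's `|det_Δ ·|_v` (`∏_{w∣v} ‖det_Δ p_w‖_w`,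
  ★ GR91 `modDelta_locToAdelic`), hence `exists_modDelta_locToAdelic_sq_eq_zpow`: `modDelta (ι_v p)² = q_v^k` (★ B2 `exists_absDetDelta_eq_zpow`);
* §2 `heightLoc_eq_modDelta_locToAdelic`: `H_{𝒦,v}(u) = modDelta (ι_v w_u)` for the LOCAL Siegel element `w_u := u · ((𝒦.kPart (ι_v u))_v)⁻¹ ∈ P_Δ(L⁺_v)` — the
  one-place case of ★ (E6) FILE 1 `K2LiuIwasawaHeightPlaceFactorisation.modDelta_pPart_eq_of_componentwise` (the componentwise-in-`K` quotient `(ι_v w_u)⁻¹ ι_v u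
  = ι_v((k_{ι_v u})_v)`; the finite guard set `T ∋ v` off which `(𝒦.K)_w ⊆ K_{H,w}` is ★ G2 §0 `exists_finset_forall_evalPlace_finPart_mem_localInt`);
* §3 **`exists_heightLoc_sq_eq_qpow`**: `∃ k : ℤ, H_{𝒦,v}(u)² = q_v^k` — THE LETTER the (R2′) monomial-flat road consumes (`q_v`-monomials `(q_v^k)^{s−s₀}` are
  `q_v^{-s}`-rational and regular everywhere, ★ B2 `isQRationalRegularAt_zpow_cpow_add`);
* §4 the cheap laws: `H_{𝒦,v}` is locally constant (`isLocallyConstant_heightLoc`), and for TWO standard data the ratio `c(u) := H_{𝒦,v}(u) ∕ H_{𝒦′,v}(u)` is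
  left-`P_Δ(L⁺_v)`-INVARIANT (`heightLoc_div_siegel_mul`), right-invariant under the open subgroup `ι_v⁻¹(𝒦.K) ⊓ ι_v⁻¹(𝒦′.K)` (`heightLoc_div_mul_of_mem`,
  `isOpen_coe_comap_inf`), locally constant, and `c(u)² ∈ q_v^ℤ` (`exists_heightLoc_div_sq_eq_qpow`).

References: [Tan1999] V. Tan, Canad. J. Math. 51 (1999) §1 p. 166 (`|a(g)|`, `Φ(g,s) = |a(g)|^{s−s₀}Φ(g,s₀)`); [HarrisKudlaSweet1996] §1 (1.15)–(1.17);
[KudlaSweet1997] §1 (values of standard sections are rational in `q^{-s}`); [BorelJacquet1979] §4.1; [GelbartRogawski1991] §3.1 (3.1.2)–(3.1.3).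
HONEST LABEL.  Count-neutral helper: `HC_CM` is proved only modulo the 7 printed citations (2 remaining named inputs: hLiu418 = `stmt-HodgeConjecture-24832`,
h413 = `stmt-HodgeConjecture-24833`) until rung 0 closes.
-/

set_option autoImplicit false
set_option linter.dupNamespace false -- the mandated namespace repeats `HodgeConjecture.HodgeConjecture`

noncomputable section

open scoped Matrix RestrictedProduct
open Filter Topology Set NumberField IsDedekindDomain
open Literature.NumberTheory.Automorphic Literature.NumberTheory.Automorphic.UnitaryGroup Literature.NumberTheory.GaloisRepresentations
open Literature.NumberTheory.GaloisRepresentations.IsNonarchimedeanLocalField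
open Literature.NumberTheory.GelbartRogawski1991 Literature.NumberTheory.GelbartRogawski1991.GRConstruction
open Literature.NumberTheory.GelbartRogawski1991.UnitaryDualPair
open Literature.NumberTheory.K2Lit.SiegelDoubled Literature.NumberTheory.K2Lit.LocalSiegelDoubled Literature.NumberTheory.K2Lit.PlaceSplitting
open Summit.HodgeConjecture.HodgeConjecture.Cruxes.HLiu418.K2LiuStdFamilyFactorisable
open Summit.HodgeConjecture.HodgeConjecture.Cruxes.HLiu418.K2LiuSiegelSectionRestrictedProduct
open Summit.HodgeConjecture.HodgeConjecture.Cruxes.HLiu418.K2LiuIwasawaDeltaUnimodular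
open Summit.HodgeConjecture.HodgeConjecture.Cruxes.HLiu418.K2LiuSiegelBigCellSectionOfLocalPrelims
open Summit.HodgeConjecture.HodgeConjecture.Cruxes.HLiu418.K2LiuIwasawaHeightPlaceFactorisation
open Summit.HodgeConjecture.HodgeConjecture.Cruxes.HLiu418.K2LiuIncoherentPatternFamily
open Summit.HodgeConjecture.HodgeConjecture.Cruxes.HLiu418.K2LiuStdFamilyAwayPurityFlat
open Summit.HodgeConjecture.HodgeConjecture.Cruxes.HLiu418.K2LiuFlatSiegelFamilies

namespace Summit.HodgeConjecture.HodgeConjecture.Cruxes.HLiu418.K2LiuIwasawaHeightLocalModulus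

variable (L : Type) [Field L] [NumberField L] [IsCMField L]
variable {N M n : ℕ} (e : Fin N × Fin M ≃ Fin n)
  (dV : Fin N → L) (hdV : ∀ i, IsCMField.complexConj L (dV i) = dV i) (hdV0 : ∀ i, dV i ≠ 0)
  (dW : Fin M → L) (hdW : ∀ i, IsCMField.complexConj L (dW i) = dW i) (hdW0 : ∀ i, dW i ≠ 0)

section LocalOne
variable (v : HeightOneSpectrum (𝓞 (Fp L)))

/-! ## §1 On `P_Δ(L⁺_v)`: `modDelta (ι_v p)² = |det_Δ p|_v ∈ q_v^ℤ` -/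

/-- **`modDelta (ι_v p)² = |det_Δ p|_v`** for `p ∈ P_Δ(L⁺_v)`: the adelic modulus `|det_Δ ·|_𝔸^{1∕2}` read at the place inclusion is `∏_{w∣v} ‖det_Δ p_w‖_w^{1∕2}`
(★ GR91 `modDelta_locToAdelic`, every `det_Δ p_w` a unit ★ `isUnit_localDetDelta_of_mem_siegelDeltaLoc`), and ★ D1 `absDetDelta = ∏_{w∣v} ‖det_Δ p_w‖_w`.
[cite: GelbartRogawski1991, §3.1 (3.1.2)–(3.1.3)] [cite: HarrisKudlaSweet1996, §1 (1.15)] -/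
theorem modDelta_locToAdelic_sq_eq_absDetDelta {p : UnitaryGroup.localPi L (IsCMField.complexConj L) (n + n) (hermD L e dV hdV dW hdW) v}
    (hp : p ∈ siegelDeltaLoc L e dV hdV dW hdW v) :
    modDelta L e dV hdV dW hdW (locToAdelic L e dV hdV dW hdW v p) ^ 2 = absDetDelta (Fp L) L (IsCMField.complexConj L) v n p := by
  have hloc : ∀ w : UnitaryGroup.PlacesOver L v,
      IsUnit (detDeltaM (((p : UnitaryGroup.LocalGLPi L (n + n) v) w : GL (Fin (n + n)) (w.1.adicCompletion L)) :
        Matrix (Fin (n + n)) (Fin (n + n)) (w.1.adicCompletion L))) :=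
    fun w => isUnit_localDetDelta_of_mem_siegelDeltaLoc L e dV hdV dW hdW v hp w
  rw [modDelta_locToAdelic L e dV hdV dW hdW v p hloc, ← Finset.prod_pow]
  unfold absDetDelta
  exact Finset.prod_congr rfl fun w _ => by rw [Real.sq_sqrt (norm_nonneg _)]; rfl

/-- **`modDelta (ι_v p)² = q_v^k` for some `k ∈ ℤ`**, `p ∈ P_Δ(L⁺_v)` (`|det_Δ p|_v ∈ q_v^ℤ`, ★ B2 `exists_absDetDelta_eq_zpow` at the δ-package of the K2Lit datum,
★ `mem_siegelDeltaLoc_iff_local`). [cite: HarrisKudlaSweet1996, §1 (1.15)] [cite: KudlaSweet1997, §1] -/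
theorem exists_modDelta_locToAdelic_sq_eq_zpow {p : UnitaryGroup.localPi L (IsCMField.complexConj L) (n + n) (hermD L e dV hdV dW hdW) v}
    (hp : p ∈ siegelDeltaLoc L e dV hdV dW hdW v) :
    ∃ k : ℤ, modDelta L e dV hdV dW hdW (locToAdelic L e dV hdV dW hdW v p) ^ 2 = (residueFieldCard (v.adicCompletion (Fp L)) : ℝ) ^ k := by
  haveI : Algebra.IsQuadraticExtension (Fp L) L := IsCMField.isQuadraticExtension L
  obtain ⟨k, hk⟩ := exists_absDetDelta_eq_zpow (Fp L) L (IsCMField.complexConj L) (complexConj_imagUnit L) (imagUnit_ne_zero L) (imagUnit_mul_self L) v n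
    (gramR_isSymm L e dV hdV dW hdW) (hermD_eq_map_gramD L e dV hdV dW hdW) ((mem_siegelDeltaLoc_iff_local L e dV hdV dW hdW v p).1 hp)
  exact ⟨k, by rw [modDelta_locToAdelic_sq_eq_absDetDelta L e dV hdV dW hdW v hp, hk]⟩

/-! ## §2 The local height is the modulus of a LOCAL Siegel element -/

/-- the `v`-component of the chosen `P`-part of `ι_v u` is `w_u := u · ((𝒦.kPart (ι_v u))_v)⁻¹` (components of `p_h · k_h = h` at `v`, ★ `(ι_v u)_v = u`). [cite: Tan1999, §1] -/
theorem evalPlace_finPart_pPart_locToAdelic (𝒦 : IwasawaDatum L e dV hdV dW hdW) (u : UnitaryGroup.localPi L (IsCMField.complexConj L) (n + n) (hermD L e dV hdV dW hdW) v) :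
    UnitaryGroup.evalPlace (Fp L) L (IsCMField.complexConj L) (n + n) (hermD L e dV hdV dW hdW) v (UnitaryGroup.finPart (Fp L) L (IsCMField.complexConj L) (n + n) (hermD L e dV hdV dW hdW) (𝒦.pPart (locToAdelic L e dV hdV dW hdW v u))) =
      u * (UnitaryGroup.evalPlace (Fp L) L (IsCMField.complexConj L) (n + n) (hermD L e dV hdV dW hdW) v (UnitaryGroup.finPart (Fp L) L (IsCMField.complexConj L) (n + n) (hermD L e dV hdV dW hdW) (𝒦.kPart (locToAdelic L e dV hdV dW hdW v u))))⁻¹ := by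
  have h1 := congrArg (fun x => UnitaryGroup.evalPlace (Fp L) L (IsCMField.complexConj L) (n + n) (hermD L e dV hdV dW hdW) v (UnitaryGroup.finPart (Fp L) L (IsCMField.complexConj L) (n + n) (hermD L e dV hdV dW hdW) x)) (𝒦.pPart_mul_kPart (locToAdelic L e dV hdV dW hdW v u))
  simp only [evalPlace_finPart_mul', evalPlace_finPart_locToAdelic_self] at h1
  exact eq_mul_inv_of_mul_eq h1

/-- … and it lies in `P_Δ(L⁺_v)` (components of Siegel elements are local Siegel elements, ★ `evalPlace_finPart_mem_siegelDeltaLoc`). [cite: Tan1999, §1] -/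
theorem mul_inv_evalPlace_kPart_mem_siegelDeltaLoc (𝒦 : IwasawaDatum L e dV hdV dW hdW) (u : UnitaryGroup.localPi L (IsCMField.complexConj L) (n + n) (hermD L e dV hdV dW hdW) v) :
    u * (UnitaryGroup.evalPlace (Fp L) L (IsCMField.complexConj L) (n + n) (hermD L e dV hdV dW hdW) v (UnitaryGroup.finPart (Fp L) L (IsCMField.complexConj L) (n + n) (hermD L e dV hdV dW hdW) (𝒦.kPart (locToAdelic L e dV hdV dW hdW v u))))⁻¹ ∈
      siegelDeltaLoc L e dV hdV dW hdW v := by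
  rw [← evalPlace_finPart_pPart_locToAdelic L e dV hdV dW hdW v 𝒦 u]
  exact evalPlace_finPart_mem_siegelDeltaLoc L e dV hdV dW hdW _ (𝒦.pPart_isSiegelDelta _) v

set_option maxHeartbeats 800000 in -- the adelic doubled unitary datum under ★ (E6) FILE 1's componentwise lemma (as ★ (E6) FILE 1 §1; measured)
include hdV0 hdW0 in
/-- **`H_{𝒦,v}(u) = modDelta (ι_v w_u)`** for `𝒦` STANDARD: the one-place case of ★ (E6) FILE 1 `modDelta_pPart_eq_of_componentwise` with `r := ι_v w_u` and the
componentwise-in-`K` quotient `r⁻¹ · ι_v u = ι_v((k_{ι_v u})_v)` (archimedean part `1 = (1)_∞`, `v`-component that of `k_{ι_v u} ∈ 𝒦.K`, components `1` elsewhere), at the finite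
guard set `T := insert v T₁`, `T₁` from ★ G2 §0. [cite: Tan1999, §1 p. 166] [cite: BorelJacquet1979, §4.1] -/
theorem heightLoc_eq_modDelta_locToAdelic {𝒦 : IwasawaDatum L e dV hdV dW hdW} (h𝒦 : 𝒦.IsStd) (u : UnitaryGroup.localPi L (IsCMField.complexConj L) (n + n) (hermD L e dV hdV dW hdW) v) :
    modDelta L e dV hdV dW hdW (𝒦.pPart (locToAdelic L e dV hdV dW hdW v u)) =
      modDelta L e dV hdV dW hdW (locToAdelic L e dV hdV dW hdW v
        (u * (UnitaryGroup.evalPlace (Fp L) L (IsCMField.complexConj L) (n + n) (hermD L e dV hdV dW hdW) v (UnitaryGroup.finPart (Fp L) L (IsCMField.complexConj L) (n + n) (hermD L e dV hdV dW hdW) (𝒦.kPart (locToAdelic L e dV hdV dW hdW v u))))⁻¹)) := by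
  classical
  obtain ⟨T₁, hT₁⟩ := exists_finset_forall_evalPlace_finPart_mem_localInt L e dV hdV dW hdW h𝒦
  have hKT : ∀ k ∈ 𝒦.K, ∀ w, w ∉ insert v T₁ → UnitaryGroup.evalPlace (Fp L) L (IsCMField.complexConj L) (n + n) (hermD L e dV hdV dW hdW) w (UnitaryGroup.finPart (Fp L) L (IsCMField.complexConj L) (n + n) (hermD L e dV hdV dW hdW) k) ∈ UnitaryGroup.localInt L (IsCMField.complexConj L) (n + n) (hermD L e dV hdV dW hdW) w :=
    fun k hk w hw => hT₁ k hk w fun h => hw (Finset.mem_insert_of_mem h)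
  have hκ : (locToAdelic L e dV hdV dW hdW v (u * (UnitaryGroup.evalPlace (Fp L) L (IsCMField.complexConj L) (n + n) (hermD L e dV hdV dW hdW) v (UnitaryGroup.finPart (Fp L) L (IsCMField.complexConj L) (n + n) (hermD L e dV hdV dW hdW) (𝒦.kPart (locToAdelic L e dV hdV dW hdW v u))))⁻¹))⁻¹ *
      locToAdelic L e dV hdV dW hdW v u = locToAdelic L e dV hdV dW hdW v (UnitaryGroup.evalPlace (Fp L) L (IsCMField.complexConj L) (n + n) (hermD L e dV hdV dW hdW) v (UnitaryGroup.finPart (Fp L) L (IsCMField.complexConj L) (n + n) (hermD L e dV hdV dW hdW) (𝒦.kPart (locToAdelic L e dV hdV dW hdW v u)))) := by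
    rw [← map_inv, ← map_mul, mul_inv_rev, inv_inv, mul_assoc, inv_mul_cancel, mul_one]
  exact modDelta_pPart_eq_of_componentwise L e dV hdV hdV0 dW hdW hdW0 (insert v T₁) h𝒦 hKT _ _ _
    ((mem_siegelDeltaLoc_iff L e dV hdV dW hdW v _).1 (mul_inv_evalPlace_kPart_mem_siegelDeltaLoc L e dV hdV dW hdW v 𝒦 u)) hκ
    ⟨1, 𝒦.K.one_mem, by rw [archPart_locToAdelic, K2LiuStdFamilyFactorisable.archPart_one']⟩
    (fun w _ => by
      by_cases hwv : w = v
      · subst hwv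
        exact ⟨𝒦.kPart (locToAdelic L e dV hdV dW hdW w u), 𝒦.kPart_mem _, by rw [evalPlace_finPart_locToAdelic_self]⟩
      · exact ⟨1, 𝒦.K.one_mem, by rw [evalPlace_finPart_locToAdelic_of_ne L e dV hdV dW hdW hwv, K2LiuStdFamilyFactorisable.finPart_one', map_one]⟩)
    (fun w hw => by
      have hwv : w ≠ v := fun h => hw (h ▸ Finset.mem_insert_self v T₁)
      rw [evalPlace_finPart_locToAdelic_of_ne L e dV hdV dW hdW hwv]
      exact one_mem _)

end LocalOne

/-! ## §3 THE LETTER: `H_{𝒦,v}(u)² ∈ q_v^ℤ` -/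

include hdV0 hdW0 in
/-- **THE SQUARE OF THE LOCAL IWASAWA HEIGHT OF A STANDARD DATUM IS AN INTEGER POWER OF `q_v`**: for `𝒦` standard, `v` finite and `u ∈ H_v`,
`∃ k : ℤ, (modDelta (𝒦.pPart (ι_v u)))² = q_v^k` (§2 + §1).  So `s ↦ H_{𝒦,v}(u)^{2(s−s₀)} = (q_v^k)^{s−s₀}` is a `q_v^{-s}`-monomial (★ B2 `isQRationalRegularAt_zpow_cpow_add`).
[cite: Tan1999, §1 p. 166] [cite: KudlaSweet1997, §1] [cite: HarrisKudlaSweet1996, §1 (1.15)] -/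
theorem exists_heightLoc_sq_eq_qpow {𝒦 : IwasawaDatum L e dV hdV dW hdW} (h𝒦 : 𝒦.IsStd) (v : HeightOneSpectrum (𝓞 (Fp L)))
    (u : UnitaryGroup.localPi L (IsCMField.complexConj L) (n + n) (hermD L e dV hdV dW hdW) v) :
    ∃ k : ℤ, modDelta L e dV hdV dW hdW (𝒦.pPart (locToAdelic L e dV hdV dW hdW v u)) ^ 2 = (residueFieldCard (v.adicCompletion (Fp L)) : ℝ) ^ k := by
  rw [heightLoc_eq_modDelta_locToAdelic L e dV hdV hdV0 dW hdW hdW0 v h𝒦 u]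
  exact exists_modDelta_locToAdelic_sq_eq_zpow L e dV hdV dW hdW v (mul_inv_evalPlace_kPart_mem_siegelDeltaLoc L e dV hdV dW hdW v 𝒦 u)

include hdV0 hdW0 in
/-- the same in the `cpow` currency of the flat twists: `(H_{𝒦,v}(u) : ℂ)^{2 z} = ((q_v^k : ℝ) : ℂ)^z` for every `z` (`H > 0`, ★ `modDelta_pos`; both sides are
`exp (2 z log H)`). [cite: Tan1999, §1 p. 166] -/
theorem exists_heightLoc_cpow_two_mul_eq {𝒦 : IwasawaDatum L e dV hdV dW hdW} (h𝒦 : 𝒦.IsStd) (v : HeightOneSpectrum (𝓞 (Fp L)))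
    (u : UnitaryGroup.localPi L (IsCMField.complexConj L) (n + n) (hermD L e dV hdV dW hdW) v) :
    ∃ k : ℤ, ∀ z : ℂ, ((modDelta L e dV hdV dW hdW (𝒦.pPart (locToAdelic L e dV hdV dW hdW v u)) : ℝ) : ℂ) ^ (2 * z) =
      ((((residueFieldCard (v.adicCompletion (Fp L)) : ℝ) ^ k : ℝ)) : ℂ) ^ z := by
  obtain ⟨k, hk⟩ := exists_heightLoc_sq_eq_qpow L e dV hdV hdV0 dW hdW hdW0 h𝒦 v u
  refine ⟨k, fun z => ?_⟩
  have hH : (0 : ℝ) < modDelta L e dV hdV dW hdW (𝒦.pPart (locToAdelic L e dV hdV dW hdW v u)) := modDelta_pos L e dV hdV dW hdW _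
  rw [← hk, Complex.cpow_def_of_ne_zero (Complex.ofReal_ne_zero.2 hH.ne'), Complex.cpow_def_of_ne_zero (Complex.ofReal_ne_zero.2 (pow_pos hH 2).ne'),
    ← Complex.ofReal_log hH.le, ← Complex.ofReal_log (pow_pos hH 2).le, Real.log_pow]
  congr 1
  push_cast
  ring

/-! ## §4 The cheap laws: local constancy, and the ratio of two datum heights -/

section LocalTwo
variable (v : HeightOneSpectrum (𝓞 (Fp L)))

include hdV0 hdW0 in
/-- **`H_{𝒦,v}` is locally constant** for `𝒦` standard (constant on the open cosets `u · ι_v⁻¹(𝒦.K)`, ★ `heightLoc_mul_of_mem` + ★ `isOpen_coe_comap_locToAdelic`).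
[cite: BorelJacquet1979, §4.1] [cite: Tan1999, §1 p. 166] -/
theorem isLocallyConstant_heightLoc {𝒦 : IwasawaDatum L e dV hdV dW hdW} (h𝒦 : 𝒦.IsStd) :
    IsLocallyConstant fun u : UnitaryGroup.localPi L (IsCMField.complexConj L) (n + n) (hermD L e dV hdV dW hdW) v => modDelta L e dV hdV dW hdW (𝒦.pPart (locToAdelic L e dV hdV dW hdW v u)) := by
  refine (IsLocallyConstant.iff_exists_open _).2 fun u => ⟨(fun k => u * k) '' (((𝒦.K).comap (locToAdelic L e dV hdV dW hdW v) : Subgroup (UnitaryGroup.localPi L (IsCMField.complexConj L) (n + n) (hermD L e dV hdV dW hdW) v)) : Set (UnitaryGroup.localPi L (IsCMField.complexConj L) (n + n) (hermD L e dV hdV dW hdW) v)),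
    (Homeomorph.mulLeft u).isOpenMap _ (isOpen_coe_comap_locToAdelic L e dV hdV dW hdW v h𝒦), ⟨1, one_mem _, mul_one u⟩, ?_⟩
  rintro _ ⟨k, hk, rfl⟩
  exact heightLoc_mul_of_mem L e dV hdV hdV0 dW hdW hdW0 v 𝒦 u (Subgroup.mem_comap.1 hk)

include hdV0 hdW0 in
/-- on a COMPACT set `H_{𝒦,v}` takes finitely many values (finite subcover of the compact by the open fibres of a locally constant function).
[cite: BorelJacquet1979, §4.1] -/
theorem finite_image_heightLoc_of_isCompact {𝒦 : IwasawaDatum L e dV hdV dW hdW} (h𝒦 : 𝒦.IsStd) {C : Set (UnitaryGroup.localPi L (IsCMField.complexConj L) (n + n) (hermD L e dV hdV dW hdW) v)}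
    (hC : IsCompact C) :
    ((fun u : UnitaryGroup.localPi L (IsCMField.complexConj L) (n + n) (hermD L e dV hdV dW hdW) v => modDelta L e dV hdV dW hdW (𝒦.pPart (locToAdelic L e dV hdV dW hdW v u))) '' C).Finite := by
  have hg := isLocallyConstant_heightLoc L e dV hdV hdV0 dW hdW hdW0 v h𝒦
  obtain ⟨t, -, hcover⟩ := hC.elim_nhds_subcover
    (fun x => (fun u : UnitaryGroup.localPi L (IsCMField.complexConj L) (n + n) (hermD L e dV hdV dW hdW) v => modDelta L e dV hdV dW hdW (𝒦.pPart (locToAdelic L e dV hdV dW hdW v u))) ⁻¹'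
      {modDelta L e dV hdV dW hdW (𝒦.pPart (locToAdelic L e dV hdV dW hdW v x))})
    fun x _ => (hg.isOpen_fiber _).mem_nhds rfl
  refine ((t.finite_toSet).image fun u : UnitaryGroup.localPi L (IsCMField.complexConj L) (n + n) (hermD L e dV hdV dW hdW) v => modDelta L e dV hdV dW hdW (𝒦.pPart (locToAdelic L e dV hdV dW hdW v u))).subset ?_
  rintro _ ⟨x, hx, rfl⟩
  obtain ⟨x₀, hx₀, hx'⟩ := Set.mem_iUnion₂.1 (hcover hx)
  exact ⟨x₀, hx₀, (show modDelta L e dV hdV dW hdW (𝒦.pPart (locToAdelic L e dV hdV dW hdW v x)) = modDelta L e dV hdV dW hdW (𝒦.pPart (locToAdelic L e dV hdV dW hdW v x₀)) from hx').symm⟩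

include hdV0 hdW0 in
/-- **left `P_Δ(L⁺_v)`-INVARIANCE of the ratio of two datum heights**: `c(p u) = c(u)` for `c := H_{𝒦,v} ∕ H_{𝒦′,v}` (both carry the factor `|det_Δ ι_v p|^{1∕2}`,
★ `heightLoc_siegel_mul`). [cite: Tan1999, §1 p. 166] [cite: HarrisKudlaSweet1996, §1 (1.15)] -/
theorem heightLoc_div_siegel_mul (𝒦 𝒦' : IwasawaDatum L e dV hdV dW hdW) {p : UnitaryGroup.localPi L (IsCMField.complexConj L) (n + n) (hermD L e dV hdV dW hdW) v}
    (hp : p ∈ siegelDeltaLoc L e dV hdV dW hdW v) (u : UnitaryGroup.localPi L (IsCMField.complexConj L) (n + n) (hermD L e dV hdV dW hdW) v) :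
    modDelta L e dV hdV dW hdW (𝒦.pPart (locToAdelic L e dV hdV dW hdW v (p * u))) / modDelta L e dV hdV dW hdW (𝒦'.pPart (locToAdelic L e dV hdV dW hdW v (p * u))) =
      modDelta L e dV hdV dW hdW (𝒦.pPart (locToAdelic L e dV hdV dW hdW v u)) / modDelta L e dV hdV dW hdW (𝒦'.pPart (locToAdelic L e dV hdV dW hdW v u)) := by
  rw [heightLoc_siegel_mul L e dV hdV hdV0 dW hdW hdW0 v 𝒦 hp u, heightLoc_siegel_mul L e dV hdV hdV0 dW hdW hdW0 v 𝒦' hp u,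
    mul_div_mul_left _ _ (modDelta_pos L e dV hdV dW hdW _).ne']

include hdV0 hdW0 in
/-- **right invariance of the ratio under `ι_v⁻¹(𝒦.K) ⊓ ι_v⁻¹(𝒦′.K)`** (★ `heightLoc_mul_of_mem` for each datum). [cite: Tan1999, §1 p. 166] -/
theorem heightLoc_div_mul_of_mem (𝒦 𝒦' : IwasawaDatum L e dV hdV dW hdW) (u : UnitaryGroup.localPi L (IsCMField.complexConj L) (n + n) (hermD L e dV hdV dW hdW) v)
    {k : UnitaryGroup.localPi L (IsCMField.complexConj L) (n + n) (hermD L e dV hdV dW hdW) v} (hk : locToAdelic L e dV hdV dW hdW v k ∈ 𝒦.K) (hk' : locToAdelic L e dV hdV dW hdW v k ∈ 𝒦'.K) :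
    modDelta L e dV hdV dW hdW (𝒦.pPart (locToAdelic L e dV hdV dW hdW v (u * k))) / modDelta L e dV hdV dW hdW (𝒦'.pPart (locToAdelic L e dV hdV dW hdW v (u * k))) =
      modDelta L e dV hdV dW hdW (𝒦.pPart (locToAdelic L e dV hdV dW hdW v u)) / modDelta L e dV hdV dW hdW (𝒦'.pPart (locToAdelic L e dV hdV dW hdW v u)) := by
  rw [heightLoc_mul_of_mem L e dV hdV hdV0 dW hdW hdW0 v 𝒦 u hk, heightLoc_mul_of_mem L e dV hdV hdV0 dW hdW hdW0 v 𝒦' u hk']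

/-- the invariance group `ι_v⁻¹(𝒦.K) ⊓ ι_v⁻¹(𝒦′.K)` of the ratio is OPEN for `𝒦, 𝒦′` standard (★ `isOpen_coe_comap_locToAdelic` twice). [cite: BorelJacquet1979, §4.1] -/
theorem isOpen_coe_comap_inf {𝒦 𝒦' : IwasawaDatum L e dV hdV dW hdW} (h𝒦 : 𝒦.IsStd) (h𝒦' : 𝒦'.IsStd) :
    IsOpen ((((𝒦.K).comap (locToAdelic L e dV hdV dW hdW v) ⊓ (𝒦'.K).comap (locToAdelic L e dV hdV dW hdW v) :
      Subgroup (UnitaryGroup.localPi L (IsCMField.complexConj L) (n + n) (hermD L e dV hdV dW hdW) v)) : Set (UnitaryGroup.localPi L (IsCMField.complexConj L) (n + n) (hermD L e dV hdV dW hdW) v))) := by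
  rw [Subgroup.coe_inf]
  exact (isOpen_coe_comap_locToAdelic L e dV hdV dW hdW v h𝒦).inter (isOpen_coe_comap_locToAdelic L e dV hdV dW hdW v h𝒦')

include hdV0 hdW0 in
/-- the ratio of two standard datum heights is locally constant. [cite: BorelJacquet1979, §4.1] -/
theorem isLocallyConstant_heightLoc_div {𝒦 𝒦' : IwasawaDatum L e dV hdV dW hdW} (h𝒦 : 𝒦.IsStd) (h𝒦' : 𝒦'.IsStd) :
    IsLocallyConstant fun u : UnitaryGroup.localPi L (IsCMField.complexConj L) (n + n) (hermD L e dV hdV dW hdW) v =>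
      modDelta L e dV hdV dW hdW (𝒦.pPart (locToAdelic L e dV hdV dW hdW v u)) / modDelta L e dV hdV dW hdW (𝒦'.pPart (locToAdelic L e dV hdV dW hdW v u)) :=
  (isLocallyConstant_heightLoc L e dV hdV hdV0 dW hdW hdW0 v h𝒦).div (isLocallyConstant_heightLoc L e dV hdV hdV0 dW hdW hdW0 v h𝒦')

include hdV0 hdW0 in
/-- **`c(u)² ∈ q_v^ℤ`** for the ratio `c := H_{𝒦,v} ∕ H_{𝒦′,v}` of two standard datum heights (§3 twice). [cite: KudlaSweet1997, §1] [cite: Tan1999, §1 p. 166] -/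
theorem exists_heightLoc_div_sq_eq_qpow {𝒦 𝒦' : IwasawaDatum L e dV hdV dW hdW} (h𝒦 : 𝒦.IsStd) (h𝒦' : 𝒦'.IsStd)
    (u : UnitaryGroup.localPi L (IsCMField.complexConj L) (n + n) (hermD L e dV hdV dW hdW) v) :
    ∃ k : ℤ, (modDelta L e dV hdV dW hdW (𝒦.pPart (locToAdelic L e dV hdV dW hdW v u)) / modDelta L e dV hdV dW hdW (𝒦'.pPart (locToAdelic L e dV hdV dW hdW v u))) ^ 2 =
      (residueFieldCard (v.adicCompletion (Fp L)) : ℝ) ^ k := by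
  obtain ⟨k, hk⟩ := exists_heightLoc_sq_eq_qpow L e dV hdV hdV0 dW hdW hdW0 h𝒦 v u
  obtain ⟨k', hk'⟩ := exists_heightLoc_sq_eq_qpow L e dV hdV hdV0 dW hdW hdW0 h𝒦' v u
  refine ⟨k - k', ?_⟩
  rw [div_pow, hk, hk', zpow_sub₀ (by exact_mod_cast residueFieldCard_ne_zero (v.adicCompletion (Fp L)))]

end LocalTwo

end Summit.HodgeConjecture.HodgeConjecture.Cruxes.HLiu418.K2LiuIwasawaHeightLocalModulus

end
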